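import Mathlib.Analysis.Matrix.Spectrum
import Mathlib.Analysis.Matrix.PosDef
import Mathlib.Topology.Algebra.MvPolynomial
import Mathlib.Topology.MetricSpace.ProperSpace
import Literature.Computability.AlgebraicComplexity.PolystabilityProofs
import Literature.Computability.AlgebraicComplexity.MS2001FormEPolystableComplex
import HarnessLib

/-!
# Kempf–Ness at a minimal vector: the stabiliser of a shortest vector of a closed `SL`-orbit is
# self-adjoint (Matsushima's theorem for forms, analytic half)

Topic `Literature/Computability/AlgebraicComplexity` (companion of `KempfNessMinimizer.lean`,
`KempfNessClosedOrbit.lean`, `PolystabilityProofs.lean`); THEOREMS ONLY (no definition, no named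
fact; D-0026). Written for the «only if» half of Mulmuley–Sohoni, *GCT II*, Thm. 1.8 (a)
(`MS08StableAdmissibility.lean`): the printed proof invokes Matsushima's theorem («since `v` is
stable, `G_v̂` is reductive [harish, matsushima]», main.tex L1125–1127, L1169–1171); here the
reductivity is obtained in the concrete form the tree can consume
(`RepresentationTheory/AlgebraicGroups/SelfAdjointGroupReductive.lean`: a SELF-ADJOINT algebraic
subgroup of `GL_n(ℂ)` is reductive), through the Kempf–Ness picture:

* `weight_eq_zero_of_expSum_midpoint` — the convexity step: for `c_j ≥ 0`, if
  `∑ c_j e^{x_j} ≥ ∑ c_j` and `∑ c_j e^{2 x_j} = ∑ c_j` then `x_j = 0` whenever `c_j ≠ 0`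
  (`e^{x} ≤ (1 + e^{2x})/2` with equality iff `x = 0`; no derivatives).
* **`tensorAct_conjTranspose_eq_self_of_tnormSq_minimal`** (Kempf–Ness 1979, proof of Thm. 0.2 /
  Matsushima): let `T` be an `n`-tensor over `ℂ^σ` of MINIMAL norm in its `SL_σ(ℂ)`-orbit
  (`‖T‖ ≤ ‖g • T‖` for `det g = 1`, tensor power action `tensorAct`, norm `tnormSq` of
  `TensorPowerAction.lean`). If `h • T = T` with `det h = 1` then `hᴴ • T = T`. Proof: `A = hᴴ h`
  is positive definite with `det A = 1`; write `A = U diag(λ) U⋆` and `Q(s) = U diag(λ^s) U⋆ ∈ SL`;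
  `s ↦ ‖Q(s) • T‖² = ∑_j c_j e^{s w_j}` (`tnormSq_tensorAct_kak`) is bounded below by its value at
  `0` (minimality) and takes the same value at `s = 1/2` (`h = u · Q(1/2)` with `u` unitary), so
  all active weights vanish, `Q(s) • T = T` for all `s`, and `hᴴ = A h⁻¹` fixes `T`.
* `isClosed_tensor_slOrbit_of_isPolystable` — for a polystable form `v` of degree `m` (the tree's
  `IsPolystable`: the coefficient image of the `SL`-orbit is Zariski closed) and a symmetric
  tensor `T₀` with polynomial shadow `v`, the tensor orbit `{g • T₀ | det g = 1}` is closed in the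
  Euclidean topology (polynomials are continuous; `tensorToPoly` is injective on symmetric
  tensors, `eq_zero_of_symm_of_coeff_tensorToPoly_eq_zero`).
* `exists_tnormSq_minimal_of_isClosed` — a closed tensor orbit `{g • T₀ | det g = 1}` contains
  a vector of minimal norm (properness of the norm on finite-dimensional tensor space).
* **`IsPolystable.exists_translate_stabilizer_star_closed`** — MATSUSHIMA FOR FORMS, analytic
  half: if `v ∈ Sym^m ℂ^σ` is polystable, some `SL`-translate `w = g₀ · v` has a stabiliser in
  `SL_σ(ℂ)` closed under `h ↦ hᴴ`: `det h = 1`, `h · w = w ⇒ hᴴ · w = w` (linear substitution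
  action `linSubst` of `LinSubst.lean`).

References: G. Kempf, L. Ness, *The length of vectors in representation spaces*, LNM 732 (1979),
Thm. 0.1 / 0.2 (proof); Y. Matsushima, *Espaces homogènes de Stein des groupes de Lie complexes*,
Nagoya Math. J. 16 (1960) (stabilisers of closed orbits are reductive); K. Mulmuley, M. Sohoni,
*Geometric complexity theory II*, SIAM J. Comput. 38 (2008), §5 (use). Mathlib:
`Matrix.IsHermitian.spectral_theorem`, `Matrix.PosDef.eigenvalues_pos`,
`Metric.isCompact_of_isClosed_isBounded`, `IsCompact.exists_isMinOn`. All statements are proved;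
honest framing: analytic bookkeeping, nothing here bears on VP versus VNP.
-/

noncomputable section

open Matrix Finset MvPolynomial
open scoped Matrix ComplexOrder

namespace Literature.Computability.AlgebraicComplexity

/-! ### The convexity step -/

section Convexity

variable {ι : Type*} [Fintype ι]

/-- `e^x ≤ (1 + e^{2x}) / 2`, i.e. `(e^x - 1)^2 ≥ 0`. [folklore] -/
private theorem exp_le_half_one_add_exp_two_mul (x : ℝ) :
    Real.exp x ≤ (1 + Real.exp (2 * x)) / 2 := by
  have h : Real.exp (2 * x) = Real.exp x ^ 2 := by
    rw [← Real.exp_nat_mul]; norm_num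
  rw [h]
  nlinarith [sq_nonneg (Real.exp x - 1)]

/-- Equality in `e^x ≤ (1 + e^{2x}) / 2` forces `x = 0`. [folklore] -/
private theorem eq_zero_of_exp_eq_half_one_add_exp_two_mul {x : ℝ}
    (hx : Real.exp x = (1 + Real.exp (2 * x)) / 2) : x = 0 := by
  have h : Real.exp (2 * x) = Real.exp x ^ 2 := by
    rw [← Real.exp_nat_mul]; norm_num
  rw [h] at hx
  have h1 : (Real.exp x - 1) ^ 2 = 0 := by nlinarith
  have h2 : Real.exp x = 1 := by
    have := pow_eq_zero_iff (n := 2) (by norm_num) |>.mp h1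
    linarith
  exact Real.exp_eq_one_iff x |>.mp h2

/-- **The convexity step of Kempf–Ness.** For non-negative `c_j`: if `∑ c_j e^{x_j} ≥ ∑ c_j` and
`∑ c_j e^{2 x_j} = ∑ c_j`, then every active exponent vanishes (`c_j ≠ 0 ⇒ x_j = 0`).
[cite: KempfNess1979, proof of Thm. 0.2 (convexity of the norm along one-parameter subgroups)] -/
theorem weight_eq_zero_of_expSum_midpoint {c x : ι → ℝ} (hc : ∀ j, 0 ≤ c j)
    (hmid : ∑ j, c j ≤ ∑ j, c j * Real.exp (x j))
    (hend : ∑ j, c j * Real.exp (2 * x j) = ∑ j, c j) {j : ι} (hj : c j ≠ 0) : x j = 0 := by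
  -- termwise `c e^x ≤ c (1 + e^{2x})/2`, summing to `∑ c e^x ≤ (∑ c + ∑ c e^{2x})/2 = ∑ c`
  have hterm : ∀ i, c i * Real.exp (x i) ≤ c i * ((1 + Real.exp (2 * x i)) / 2) := fun i =>
    mul_le_mul_of_nonneg_left (exp_le_half_one_add_exp_two_mul _) (hc i)
  have hsum : ∑ i, c i * ((1 + Real.exp (2 * x i)) / 2) = ∑ i, c i := by
    have : ∑ i, c i * ((1 + Real.exp (2 * x i)) / 2) =
        (∑ i, c i + ∑ i, c i * Real.exp (2 * x i)) / 2 := by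
      rw [eq_div_iff two_ne_zero, Finset.sum_mul, ← Finset.sum_add_distrib]
      refine Finset.sum_congr rfl fun i _ => ?_
      ring
    rw [this, hend]; ring
  have heq : ∀ i ∈ (Finset.univ : Finset ι),
      c i * Real.exp (x i) = c i * ((1 + Real.exp (2 * x i)) / 2) := by
    refine (Finset.sum_eq_sum_iff_of_le fun i _ => hterm i).mp ?_
    exact le_antisymm (Finset.sum_le_sum fun i _ => hterm i) (by rw [hsum]; exact hmid)
  have h := heq j (Finset.mem_univ j)
  rcases (hc j).lt_or_eq with hpos | hzero
  · exact eq_zero_of_exp_eq_half_one_add_exp_two_mul (mul_left_cancel₀ hpos.ne' h)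
  · exact absurd hzero.symm hj

end Convexity

/-! ### Kempf–Ness at a minimal vector: the stabiliser is closed under `h ↦ hᴴ` -/

section MinimalVector

variable {σ : Type*} [Fintype σ] [DecidableEq σ] {n : ℕ}

/-- A matrix of determinant `1` fixing a tensor: its inverse fixes the tensor. [folklore] -/
private theorem tensorAct_inv_eq_self_of_tensorAct_eq_self {h : Matrix σ σ ℂ} (hh : h.det = 1)
    {T : (Fin n → σ) → ℂ} (hfix : tensorAct h T = T) : tensorAct h⁻¹ T = T := by
  have hu : IsUnit h.det := by rw [hh]; exact isUnit_one
  conv_lhs => rw [← hfix]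
  rw [← tensorAct_mul, Matrix.nonsing_inv_mul _ hu, tensorAct_one]

/-- **Kempf–Ness at a minimal vector (Matsushima's theorem, analytic half).** Let `T` be a
tensor of minimal norm in its `SL_σ(ℂ)`-orbit: `‖T‖² ≤ ‖g • T‖²` whenever `det g = 1`. Then the
stabiliser of `T` in `SL_σ(ℂ)` is closed under the conjugate transpose: `det h = 1` and
`h • T = T` imply `hᴴ • T = T`. Proof: the positive definite `A = hᴴ h = U diag(λ) U⋆` has
`det A = 1`; along the one-parameter subgroup `Q(s) = U diag(λ^s) U⋆ ⊆ SL` the squared norm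
`‖Q(s) • T‖² = ∑_j c_j e^{s w_j}` is `≥ ‖T‖²` (minimality) and equals `‖T‖²` at `s = 1/2`
(`h = u Q(1/2)`, `u` unitary); by convexity all active weights vanish, so `Q(s)` fixes `T`, and
`hᴴ = A h⁻¹` fixes `T`. [cite: KempfNess1979, Thm. 0.1 and proof of Thm. 0.2] -/
theorem tensorAct_conjTranspose_eq_self_of_tnormSq_minimal {T : (Fin n → σ) → ℂ}
    (hmin : ∀ g : Matrix σ σ ℂ, g.det = 1 → tnormSq T ≤ tnormSq (tensorAct g T))
    {h : Matrix σ σ ℂ} (hh : h.det = 1) (hfix : tensorAct h T = T) :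
    tensorAct hᴴ T = T := by
  classical
  -- the positive definite matrix `A = hᴴ h` and its spectral decomposition
  have hu : IsUnit h.det := by rw [hh]; exact isUnit_one
  have hunit : IsUnit h := (Matrix.isUnit_iff_isUnit_det h).mpr hu
  set A : Matrix σ σ ℂ := hᴴ * h with hAdef
  have hApos : A.PosDef :=
    Matrix.PosDef.conjTranspose_mul_self _ (Matrix.mulVec_injective_of_isUnit hunit)
  have hAh : A.IsHermitian := hApos.1
  set U : Matrix.unitaryGroup σ ℂ := hAh.eigenvectorUnitary with hUdef
  set lam : σ → ℝ := hAh.eigenvalues with hlamdef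
  have hlam : ∀ i, 0 < lam i := hApos.eigenvalues_pos
  have hAspec : A = (U : Matrix σ σ ℂ) * Matrix.diagonal (fun i => ((lam i : ℝ) : ℂ)) *
      star (U : Matrix σ σ ℂ) := by
    have h := hAh.spectral_theorem
    rw [Unitary.conjStarAlgAut_apply] at h
    exact h
  have hUU : star (U : Matrix σ σ ℂ) * (U : Matrix σ σ ℂ) = 1 := Unitary.coe_star_mul_self U
  have hUU' : (U : Matrix σ σ ℂ) * star (U : Matrix σ σ ℂ) = 1 := Unitary.coe_mul_star_self U
  have hUH : (U : Matrix σ σ ℂ)ᴴ * (U : Matrix σ σ ℂ) = 1 := by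
    rw [← Matrix.star_eq_conjTranspose]; exact hUU
  -- `det A = 1`, so `∏ λ_i = 1` and `∑ log λ_i = 0`
  set θ : σ → ℝ := fun i => Real.log (lam i) with hθdef
  have hdetA : A.det = 1 := by
    rw [hAdef, Matrix.det_mul, Matrix.det_conjTranspose, hh, star_one, one_mul]
  have hprod : ∏ i, lam i = 1 := by
    have h1 : (∏ i, ((lam i : ℝ) : ℂ)) = 1 := by
      have h2 := hdetA
      rw [hAspec, Matrix.det_mul, Matrix.det_mul, Matrix.det_diagonal] at h2
      have h3 : Matrix.det (U : Matrix σ σ ℂ) * Matrix.det (star (U : Matrix σ σ ℂ)) = 1 := by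
        rw [← Matrix.det_mul, hUU', Matrix.det_one]
      calc (∏ i, ((lam i : ℝ) : ℂ))
          = (∏ i, ((lam i : ℝ) : ℂ)) *
              (Matrix.det (U : Matrix σ σ ℂ) * Matrix.det (star (U : Matrix σ σ ℂ))) := by
            rw [h3, mul_one]
        _ = 1 := by rw [← h2]; ring
    exact_mod_cast (show ((∏ i, lam i : ℝ) : ℂ) = 1 by rw [Complex.ofReal_prod]; exact h1)
  have hθsum : ∑ i, θ i = 0 := by
    simp only [hθdef]
    rw [← Real.log_prod (s := Finset.univ) (f := lam) fun i _ => (hlam i).ne', hprod, Real.log_one]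
  -- the one-parameter subgroup `Q(s) = U diag(e^{s log λ}) U⋆`
  set Q : ℝ → Matrix σ σ ℂ := fun s => (U : Matrix σ σ ℂ) *
    Matrix.diagonal (fun c => (Real.exp (s * θ c) : ℂ)) * star (U : Matrix σ σ ℂ) with hQdef
  have hQdet : ∀ s, (Q s).det = 1 := fun s => by
    simp only [hQdef]
    rw [Matrix.det_mul, Matrix.det_mul, det_diagonal_exp_eq_one hθsum, mul_one, ← Matrix.det_mul,
      hUU', Matrix.det_one]
  have hQadd : ∀ s t, Q (s + t) = Q s * Q t := by
    intro s t
    simp only [hQdef]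
    have hd : (fun c : σ => (Real.exp ((s + t) * θ c) : ℂ)) =
        fun c => (Real.exp (s * θ c) : ℂ) * (Real.exp (t * θ c) : ℂ) := by
      funext c
      rw [← Complex.ofReal_mul, ← Real.exp_add]; ring_nf
    symm
    calc (U : Matrix σ σ ℂ) * Matrix.diagonal (fun c => (Real.exp (s * θ c) : ℂ)) *
          star (U : Matrix σ σ ℂ) *
          ((U : Matrix σ σ ℂ) * Matrix.diagonal (fun c => (Real.exp (t * θ c) : ℂ)) *
            star (U : Matrix σ σ ℂ))
        = (U : Matrix σ σ ℂ) * Matrix.diagonal (fun c => (Real.exp (s * θ c) : ℂ)) *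
            (star (U : Matrix σ σ ℂ) * (U : Matrix σ σ ℂ)) *
            Matrix.diagonal (fun c => (Real.exp (t * θ c) : ℂ)) * star (U : Matrix σ σ ℂ) := by
          simp only [Matrix.mul_assoc]
      _ = _ := by
          rw [hUU, Matrix.mul_one, Matrix.mul_assoc (U : Matrix σ σ ℂ), Matrix.diagonal_mul_diagonal,
            ← hd]
  have hQzero : Q 0 = 1 := by
    simp only [hQdef]
    have hd : (fun c : σ => (Real.exp (0 * θ c) : ℂ)) = fun _ => 1 := by
      funext c; rw [zero_mul, Real.exp_zero, Complex.ofReal_one]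
    rw [hd, Matrix.diagonal_one, Matrix.mul_one, hUU']
  have hQone : Q 1 = A := by
    simp only [hQdef]
    have hd : (fun c : σ => (Real.exp (1 * θ c) : ℂ)) = fun c => ((lam c : ℝ) : ℂ) := by
      funext c; rw [one_mul, hθdef, Real.exp_log (hlam c)]
    rw [hd, ← hAspec]
  have hQstar : ∀ s, (Q s)ᴴ = Q s := by
    intro s
    have hd : star (fun c : σ => (Real.exp (s * θ c) : ℂ)) = fun c => (Real.exp (s * θ c) : ℂ) := by
      funext c
      simp only [Pi.star_apply, Complex.star_def, Complex.conj_ofReal]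
    simp only [hQdef]
    rw [Matrix.conjTranspose_mul, Matrix.conjTranspose_mul, Matrix.diagonal_conjTranspose,
      ← Matrix.star_eq_conjTranspose, ← Matrix.star_eq_conjTranspose, star_star, Matrix.mul_assoc,
      hd]
  -- the norm along `Q`: `‖Q(s) • T‖² = ∑_j c_j e^{2 s W_j}`
  set c : (Fin n → σ) → ℝ := fun j => ‖tensorAct (star (U : Matrix σ σ ℂ)) T j‖ ^ 2 with hcdef
  set W : (Fin n → σ) → ℝ := fun j => ∑ k, θ (j k) with hWdef
  have hc : ∀ j, 0 ≤ c j := fun j => by positivity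
  have hnormQ : ∀ s, tnormSq (tensorAct (Q s) T) = ∑ j, c j * Real.exp (2 * s * W j) := by
    intro s
    simp only [hQdef]
    rw [tnormSq_tensorAct_kak hUH (fun c => s * θ c) (star (U : Matrix σ σ ℂ)) T]
    refine Finset.sum_congr rfl fun j _ => ?_
    have h2 : (2 * ∑ k, s * θ (j k)) = 2 * s * W j := by
      simp only [hWdef, Finset.mul_sum]
      exact Finset.sum_congr rfl fun k _ => by ring
    rw [h2, mul_comm]
  have hnorm0 : tnormSq T = ∑ j, c j := by
    have h0 := hnormQ 0
    rw [hQzero, tensorAct_one] at h0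
    rw [h0]
    refine Finset.sum_congr rfl fun j _ => ?_
    rw [mul_zero, zero_mul, Real.exp_zero, mul_one]
  -- `‖Q(1/2) • T‖ = ‖T‖`: `h = u Q(1/2)` with `u = h Q(-1/2)` unitary
  have hhalf : tnormSq (tensorAct (Q (1 / 2)) T) = tnormSq T := by
    set u : Matrix σ σ ℂ := h * Q (-(1 / 2)) with hudef
    have hustar : uᴴ * u = 1 := by
      rw [hudef, Matrix.conjTranspose_mul, hQstar, Matrix.mul_assoc, ← Matrix.mul_assoc hᴴ,
        ← hAdef, ← hQone, ← hQadd, ← hQadd]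
      norm_num
      exact hQzero
    have hhu : h = u * Q (1 / 2) := by
      rw [hudef, Matrix.mul_assoc, ← hQadd]
      norm_num
      rw [hQzero, Matrix.mul_one]
    conv_rhs => rw [← hfix, hhu, tensorAct_mul, tnormSq_tensorAct_of_conjTranspose_mul_self hustar]
  -- convexity: all active weights vanish
  have hweights : ∀ j, c j ≠ 0 → W j = 0 := by
    intro j hj
    have hmid : ∑ j, c j ≤ ∑ j, c j * Real.exp ((1 / 2 : ℝ) * W j) := by
      have h1 := hmin (Q (1 / 4)) (hQdet _)
      rw [hnorm0, hnormQ] at h1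
      refine h1.trans_eq (Finset.sum_congr rfl fun i _ => ?_)
      norm_num
    have hend : ∑ j, c j * Real.exp (2 * ((1 / 2 : ℝ) * W j)) = ∑ j, c j := by
      rw [← hnorm0, ← hhalf, hnormQ]
      refine Finset.sum_congr rfl fun i _ => ?_
      rw [show (2 : ℝ) * ((1 / 2 : ℝ) * W i) = 2 * (1 / 2) * W i by ring]
    have := weight_eq_zero_of_expSum_midpoint hc hmid hend hj
    have h2 : (1 / 2 : ℝ) ≠ 0 := by norm_num
    exact (mul_eq_zero.mp this).resolve_left h2
  -- hence `Q(s) • T = T` for every `s`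
  have hQfix : ∀ s, tensorAct (Q s) T = T := by
    intro s
    have hsupp : ∀ j, tensorAct (star (U : Matrix σ σ ℂ)) T j ≠ 0 → ∑ k, θ (j k) = 0 := by
      intro j hj
      refine hweights j ?_
      rw [hcdef]
      exact pow_ne_zero 2 (norm_ne_zero_iff.mpr hj)
    simp only [hQdef]
    rw [tensorAct_mul, tensorAct_mul, tensorAct_diagonal_exp_eq_self hsupp s, ← tensorAct_mul, hUU',
      tensorAct_one]
  -- and `hᴴ = A h⁻¹` fixes `T`
  have hinvfix := tensorAct_inv_eq_self_of_tensorAct_eq_self hh hfix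
  have hhA : hᴴ = A * h⁻¹ := by
    rw [hAdef, Matrix.mul_assoc, Matrix.mul_nonsing_inv _ hu, Matrix.mul_one]
  rw [hhA, tensorAct_mul, hinvfix, ← hQone, hQfix]

end MinimalVector

/-! ### From polystable forms to closed tensor orbits with a shortest vector -/

section Forms

variable {σ : Type*} [Fintype σ] [DecidableEq σ] {m : ℕ}

omit [Fintype σ] [DecidableEq σ] in
/-- Symmetric tensors form a closed subset of tensor space. [folklore] -/
private theorem isClosed_setOf_symmetric :
    IsClosed {S : (Fin m → σ) → ℂ | ∀ (π : Equiv.Perm (Fin m)) (j : Fin m → σ), S (j ∘ π) = S j} := by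
  have : {S : (Fin m → σ) → ℂ | ∀ (π : Equiv.Perm (Fin m)) (j : Fin m → σ), S (j ∘ π) = S j} =
      ⋂ π : Equiv.Perm (Fin m), ⋂ j : Fin m → σ, {S | S (j ∘ π) = S j} := by
    ext S; simp
  rw [this]
  exact isClosed_iInter fun π => isClosed_iInter fun j =>
    isClosed_eq (continuous_apply _) (continuous_apply _)

omit [DecidableEq σ] in
/-- The coefficient vector of the polynomial shadow depends continuously on the tensor.
[folklore] -/
private theorem continuous_coeffVec_tensorToPoly :
    Continuous fun S : (Fin m → σ) → ℂ => coeffVec (tensorToPoly S) := by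
  classical
  refine continuous_pi fun d => ?_
  simp only [coeffVec_apply, coeff_tensorToPoly]
  exact continuous_finsetSum _ fun j _ => continuous_apply j

/-- `tensorToPoly` is injective on symmetric tensors. [folklore] -/
private theorem eq_of_symm_of_tensorToPoly_eq {S S' : (Fin m → σ) → ℂ}
    (hS : ∀ (π : Equiv.Perm (Fin m)) (j : Fin m → σ), S (j ∘ π) = S j)
    (hS' : ∀ (π : Equiv.Perm (Fin m)) (j : Fin m → σ), S' (j ∘ π) = S' j)
    (h : tensorToPoly S = tensorToPoly S') : S = S' := by
  have hsub : ∀ (π : Equiv.Perm (Fin m)) (j : Fin m → σ), (S - S') (j ∘ π) = (S - S') j :=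
    fun π j => by simp only [Pi.sub_apply, hS π j, hS' π j]
  have h0 : tensorToPoly (S - S') = 0 := by
    have := map_sub (tensorToPolyLin (R := ℂ) (σ := σ) (n := m)) S S'
    simp only [tensorToPolyLin_apply] at this
    rw [this, h, sub_self]
  have := eq_zero_of_symm_of_coeff_tensorToPoly_eq_zero hsub fun j => by rw [h0, coeff_zero]
  exact sub_eq_zero.mp this

/-- **Closed tensor orbit of a polystable form.** If `v` is a polystable form of degree `m`
(`IsPolystable`: the coefficient image of `SL · v` is Zariski closed) and `T₀` is a symmetric
`m`-tensor with polynomial shadow `v`, then the tensor orbit `{g • T₀ | det g = 1}` is closed in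
the Euclidean topology. [cite: BurgisserIkenmeyer2017, Def. 2.7 (with Mulmuley–Sohoni 2001 §4.1: Zariski-closed orbits are Euclidean closed)] -/
theorem isClosed_tensor_slOrbit_of_isPolystable {v : MvPolynomial σ ℂ} (hst : IsPolystable v)
    {T₀ : (Fin m → σ) → ℂ} (hsymm : ∀ (π : Equiv.Perm (Fin m)) (j : Fin m → σ), T₀ (j ∘ π) = T₀ j)
    (hT₀ : tensorToPoly T₀ = v) :
    IsClosed {S : (Fin m → σ) → ℂ | ∃ g : Matrix σ σ ℂ, g.det = 1 ∧ tensorAct g T₀ = S} := by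
  classical
  set O := {S : (Fin m → σ) → ℂ | ∃ g : Matrix σ σ ℂ, g.det = 1 ∧ tensorAct g T₀ = S} with hO
  rw [← closure_subset_iff_isClosed]
  intro S hS
  -- `S` is symmetric
  have hSsymm : ∀ (π : Equiv.Perm (Fin m)) (j : Fin m → σ), S (j ∘ π) = S j := by
    have hsub : O ⊆ {S : (Fin m → σ) → ℂ |
        ∀ (π : Equiv.Perm (Fin m)) (j : Fin m → σ), S (j ∘ π) = S j} := by
      rintro _ ⟨g, -, rfl⟩ π j
      exact tensorAct_symm hsymm g π j
    exact closure_minimal hsub isClosed_setOf_symmetric hS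
  -- the shadow of `S` lies in the Zariski closure of the coefficient image of `SL · v`
  have hZ : coeffVec (tensorToPoly S) ∈ zariskiClosure (coeffVec '' slOrbit σ ℂ v) := by
    rw [mem_zariskiClosure_iff]
    intro p hp
    have hcont : Continuous fun S' : (Fin m → σ) → ℂ => aeval (coeffVec (tensorToPoly S')) p := by
      have := (MvPolynomial.continuous_eval p).comp
        (continuous_coeffVec_tensorToPoly (σ := σ) (m := m))
      refine this.congr fun S' => ?_
      simp only [Function.comp_apply, aeval_eq_eval]
    have hzero : O ⊆ {S' | aeval (coeffVec (tensorToPoly S')) p = 0} := by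
      rintro _ ⟨g, hg, rfl⟩
      refine hp _ ⟨linSubst σ ℂ g v, ⟨⟨g, hg⟩, rfl⟩, ?_⟩
      rw [tensorToPoly_tensorAct, hT₀]
    exact closure_minimal hzero (isClosed_eq hcont continuous_const) hS
  obtain ⟨_, ⟨g, rfl⟩, hg⟩ := hst hZ
  refine ⟨(g : Matrix σ σ ℂ), g.2, ?_⟩
  refine eq_of_symm_of_tensorToPoly_eq (fun π j => tensorAct_symm hsymm _ π j) hSsymm ?_
  rw [tensorToPoly_tensorAct, hT₀]
  exact coeffVec_injective hg.symm ▸ rfl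

omit [DecidableEq σ] in
/-- **Shortest vectors exist on closed orbits** (properness of the norm): a closed tensor orbit
`{g • T₀ | det g = 1}` contains a tensor of minimal norm. [cite: KempfNess1979, Thm. 0.1] -/
theorem exists_tnormSq_minimal_of_isClosed [DecidableEq σ] {T₀ : (Fin m → σ) → ℂ}
    (hclosed : IsClosed {S : (Fin m → σ) → ℂ | ∃ g : Matrix σ σ ℂ, g.det = 1 ∧ tensorAct g T₀ = S}) :
    ∃ g₀ : Matrix σ σ ℂ, g₀.det = 1 ∧ ∀ g : Matrix σ σ ℂ, g.det = 1 →
      tnormSq (tensorAct g₀ T₀) ≤ tnormSq (tensorAct g T₀) := by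
  set O := {S : (Fin m → σ) → ℂ | ∃ g : Matrix σ σ ℂ, g.det = 1 ∧ tensorAct g T₀ = S} with hO
  set K := O ∩ {S | tnormSq S ≤ tnormSq T₀} with hK
  have hKclosed : IsClosed K :=
    hclosed.inter (isClosed_le continuous_tnormSq continuous_const)
  have hKbdd : Bornology.IsBounded K := by
    rw [isBounded_iff_forall_norm_le]
    refine ⟨Real.sqrt (tnormSq T₀), fun S hS => ?_⟩
    rw [pi_norm_le_iff_of_nonneg (Real.sqrt_nonneg _)]
    intro j
    have hj : ‖S j‖ ^ 2 ≤ tnormSq T₀ :=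
      (Finset.single_le_sum (fun i _ => sq_nonneg ‖S i‖) (Finset.mem_univ j)).trans hS.2
    exact Real.le_sqrt_of_sq_le hj
  have hKcpt : IsCompact K := Metric.isCompact_of_isClosed_isBounded hKclosed hKbdd
  have hT₀K : T₀ ∈ K := ⟨⟨1, Matrix.det_one, tensorAct_one T₀⟩, (le_refl _ : tnormSq T₀ ≤ tnormSq T₀)⟩
  obtain ⟨S, hSK, hSmin⟩ := hKcpt.exists_isMinOn ⟨T₀, hT₀K⟩ continuous_tnormSq.continuousOn
  obtain ⟨⟨g₀, hg₀, rfl⟩, hle⟩ := hSK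
  refine ⟨g₀, hg₀, fun g hg => ?_⟩
  by_cases hgK : tensorAct g T₀ ∈ K
  · exact hSmin hgK
  · have : ¬ tnormSq (tensorAct g T₀) ≤ tnormSq T₀ := fun hc => hgK ⟨⟨g, hg, rfl⟩, hc⟩
    exact hle.trans (le_of_not_ge this)

/-- **Matsushima for forms, analytic half (Kempf–Ness).** If `v ∈ Sym^m ℂ^σ` is a polystable form
(closed `SL_σ(ℂ)`-orbit), then some `SL`-translate `w = g₀ · v` has a stabiliser in `SL_σ(ℂ)`
that is closed under the conjugate transpose: for `det h = 1`, `h · w = w` implies `hᴴ · w = w`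
(linear substitution action `linSubst`). Take `w` the shadow of a shortest vector in the closed
tensor orbit of the symmetric tensor of `v`. [cite: KempfNess1979, Thm. 0.1 and proof of Thm. 0.2] -/
theorem IsPolystable.exists_translate_stabilizer_star_closed {v : MvPolynomial σ ℂ}
    (hv : v.IsHomogeneous m) (hst : IsPolystable v) :
    ∃ g₀ : Matrix σ σ ℂ, g₀.det = 1 ∧ ∀ h : Matrix σ σ ℂ, h.det = 1 →
      linSubst σ ℂ h (linSubst σ ℂ g₀ v) = linSubst σ ℂ g₀ v →
      linSubst σ ℂ hᴴ (linSubst σ ℂ g₀ v) = linSubst σ ℂ g₀ v := by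
  classical
  set T₀ : (Fin m → σ) → ℂ := MS2001Thm73.symTensor m v with hT₀def
  have hsymm : ∀ (π : Equiv.Perm (Fin m)) (j : Fin m → σ), T₀ (j ∘ π) = T₀ j :=
    fun π j => MS2001Thm73.symTensor_comp_perm v π j
  have hT₀ : tensorToPoly T₀ = v := MS2001Thm73.tensorToPoly_symTensor hv
  have hclosed := isClosed_tensor_slOrbit_of_isPolystable hst hsymm hT₀
  obtain ⟨g₀, hg₀, hmin₀⟩ := exists_tnormSq_minimal_of_isClosed hclosed
  refine ⟨g₀, hg₀, fun h hh hfix => ?_⟩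
  set T := tensorAct g₀ T₀ with hTdef
  have hTsymm : ∀ (π : Equiv.Perm (Fin m)) (j : Fin m → σ), T (j ∘ π) = T j :=
    fun π j => tensorAct_symm hsymm g₀ π j
  have hmin : ∀ g : Matrix σ σ ℂ, g.det = 1 → tnormSq T ≤ tnormSq (tensorAct g T) := by
    intro g hg
    rw [hTdef, ← tensorAct_mul]
    exact hmin₀ (g * g₀) (by rw [Matrix.det_mul, hg, hg₀, mul_one])
  have hw : tensorToPoly T = linSubst σ ℂ g₀ v := by rw [hTdef, tensorToPoly_tensorAct, hT₀]
  have hfixT : tensorAct h T = T := by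
    refine eq_of_symm_of_tensorToPoly_eq (fun π j => tensorAct_symm hTsymm h π j) hTsymm ?_
    rw [tensorToPoly_tensorAct, hw, hfix]
  have key := tensorAct_conjTranspose_eq_self_of_tnormSq_minimal hmin hh hfixT
  rw [← hw, ← tensorToPoly_tensorAct, key]

end Forms

end Literature.Computability.AlgebraicComplexity

end
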